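import Mathlib
import HarnessLib

/-!
# Route `KLProgramme` — the ALL-ORDERS implicit-function tower of a curve inside a level set (Faà di Bruno along the curve):
# `|De(f θ)[f⁽ⁿ⁾(θ)]|` is bounded by the blocks-`≥ 2` part of the Bell sum of the LOWER jets, and the polar solve `f = u • w`

Cell `gate-hubbard-kl`, seat hubbard-kl-k3c3-p3 (g18; row «implicit-function / monotonicity route»).  Located brick «(T)-TOWER-56» for the
(C)-closer lane (stub (C) `stub_twoLeg_curvature` of `KLRegimeEngineV17F2`, stmt-HubbardSuperconductivity-20437; c4a-1 C4A-PLAN §24.9: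
«orders 3–4 at (T) wait for tables msD 5,6 / K₅,K₆»).  The tree keys the frame's curve tower `‖∂ⁱ_ϑ Φ_K(ρ,ϑ)‖ ≤ msD A₃ A₄ i` to ORDER
FOUR by hand-written Faà di Bruno identities (`…PerturbedFermiCurveLevelChain`, 15 nested terms at order 4).  Orders 5 and 6 would be 52 and
203 nested terms; instead this module proves the tower step GENERICALLY IN THE ORDER `n`, from Mathlib's one-dimensional Faà di Bruno formula
`iteratedDeriv_vcomp_eq_sum_orderedFinpartition`:

* §1 ordered finpartitions: `ofp_sum_partSize` (`Σ_m |block_m| = n`), `ofp_partSize_eq_of_length_eq_one` (one block ⇒ it is everything),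
  `ofp_partSize_le_of_length_ne_one` (≥ 2 blocks ⇒ every block has size `≤ n − 1`), `ofp_exists_length_eq_one` (the one-block partition),
  `card_orderedFinpartition_le_factorial` (`#OrderedFinpartition n ≤ n!`, from Mathlib's `extendEquiv`);
* §2 **`abs_fderiv_iteratedDeriv_le_of_level`** — for `e : V → ℝ`, `f : ℝ → V` of class `Cⁿ` with `e ∘ f ≡ c₀`:
  `|De(f θ)[f⁽ⁿ⁾(θ)]| ≤ Σ_{c : OrderedFinpartition n, c.length ≠ 1} E(c.length) · Π_m F(c.partSize m)` whenever `‖Dᵐe(f θ)‖ ≤ E m`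
  (`2 ≤ m ≤ n`) and `‖f⁽ⁱ⁾(θ)‖ ≤ F i` (`1 ≤ i ≤ n − 1`) — ONLY the jets below `n` enter (the one-block term is `De[f⁽ⁿ⁾]` itself);
  `levelRemSum_le_factorial` — the crude closed form `≤ n! · E_max · Dⁿ` (`E m ≤ E_max`, `F i ≤ Dⁱ`);
* §3 the polar solve: `iteratedDeriv_smul_eq_top_add` (`(u•w)⁽ⁿ⁾ = u⁽ⁿ⁾•w + Σ_{i<n} C(n,i) u⁽ⁱ⁾•w⁽ⁿ⁻ⁱ⁾`), `norm_iteratedDeriv_smul_le_of_frame`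
  (`‖(u•w)⁽ⁿ⁾‖ ≤ Σ_{i≤n} C(n,i) Rᵢ` for a frame with `‖w⁽ᵏ⁾‖ ≤ 1`), **`abs_iteratedDeriv_radius_le_of_level`**
  (`|u⁽ⁿ⁾(θ)| ≤ (levelRemSum + E₁·Σ_{i<n} C(n,i) Rᵢ)/ρ₀` from the radial slope `ρ₀ ≤ De(f θ)[w θ]`).

Everything is PROVED, generic over a real normed space `V`; no definitions; nothing about the Hubbard model (the frame instantiation at orders
5, 6 is `…PerturbedFermiCurveTowerOfSizesSix`).  References: BGM 2006 §2.4 Lemma 2.1 (2.40) `|∂ⁿ_θ u(θ)| ≤ Cₙ`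
[cite: BenfattoGiulianiMastropietro2006]; Faà di Bruno's formula [Mathlib `Mathlib.Analysis.Calculus.IteratedDeriv.FaaDiBruno`].
-/

noncomputable section

namespace Summit.HubbardSuperconductivity.HubbardSuperconductivity.Theorems.PerturbedFermiCurve

set_option linter.dupNamespace false -- summit = problem name (single-conjunct summit), D-0017

open Real Set Finset

/-! ## §1 Ordered finpartitions: block sizes, the one-block partition, a cardinality bound -/

/-- The block sizes of an ordered finpartition of `Fin n` add up to `n`. [folklore] -/
theorem ofp_sum_partSize {n : ℕ} (c : OrderedFinpartition n) : ∑ m, c.partSize m = n := by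
  have h := c.sum_sigma_eq_sum (fun _ : Fin n => (1 : ℕ))
  simpa using h

/-- A one-block ordered finpartition of `Fin n`: its block is everything. [folklore] -/
theorem ofp_partSize_eq_of_length_eq_one {n : ℕ} (c : OrderedFinpartition n) (h : c.length = 1) (m : Fin c.length) :
    c.partSize m = n := by
  have hs := ofp_sum_partSize c
  have : Subsingleton (Fin c.length) := by rw [h]; infer_instance
  rwa [Fintype.sum_subsingleton _ m] at hs

/-- An ordered finpartition of `Fin n` with a number of blocks `≠ 1` has every block of size `≤ n − 1`. [folklore] -/
theorem ofp_partSize_le_of_length_ne_one {n : ℕ} (c : OrderedFinpartition n) (h : c.length ≠ 1) (m : Fin c.length) :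
    c.partSize m ≤ n - 1 := by
  have h2 : 2 ≤ c.length := by have := m.2; omega
  haveI : Nontrivial (Fin c.length) := Fin.nontrivial_iff_two_le.2 h2
  obtain ⟨m', hm'⟩ := exists_ne m
  have hs := ofp_sum_partSize c
  have hsub : c.partSize m + c.partSize m' ≤ ∑ i, c.partSize i := by
    rw [← Finset.sum_pair hm'.symm]
    exact Finset.sum_le_sum_of_subset (Finset.subset_univ _)
  have := c.partSize_pos m'
  omega

/-- In a one-block-or-more partition of `Fin n`, `n ≥ 1`, the number of blocks lies in `[1, n]`; if it is not `1` it is at least `2`. [folklore] -/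
theorem ofp_two_le_length {n : ℕ} (hn : 1 ≤ n) (c : OrderedFinpartition n) (h : c.length ≠ 1) : 2 ≤ c.length := by
  have := c.length_pos hn; omega

/-- For `n ≥ 1` there is an ordered finpartition of `Fin n` with exactly one block. [folklore] -/
theorem ofp_exists_length_eq_one {n : ℕ} (hn : 1 ≤ n) : ∃ c : OrderedFinpartition n, c.length = 1 :=
  ⟨{ length := 1
     partSize := fun _ => n
     partSize_pos := fun _ => hn
     emb := fun _ => id
     emb_strictMono := fun _ => strictMono_id
     parts_strictMono := Subsingleton.strictMono _
     disjoint := fun i _ j _ hij => absurd (Subsingleton.elim i j) hij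
     cover := fun x => ⟨0, x, rfl⟩ }, rfl⟩

/-- **`#OrderedFinpartition n ≤ n!`** (the Bell number is at most the factorial), from Mathlib's `OrderedFinpartition.extendEquiv`:
`#(n+1) = Σ_c (c.length + 1) ≤ (n+1)·#n`. [folklore] -/
theorem card_orderedFinpartition_le_factorial (n : ℕ) : Fintype.card (OrderedFinpartition n) ≤ n.factorial := by
  induction n with
  | zero => simp
  | succ n ih =>
    rw [← Fintype.card_congr (OrderedFinpartition.extendEquiv n), Fintype.card_sigma]
    calc ∑ c : OrderedFinpartition n, Fintype.card (Option (Fin c.length)) = ∑ c : OrderedFinpartition n, (c.length + 1) := by simp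
      _ ≤ ∑ _c : OrderedFinpartition n, (n + 1) := Finset.sum_le_sum fun c _ => by have := c.length_le; omega
      _ = Fintype.card (OrderedFinpartition n) * (n + 1) := by simp
      _ ≤ n.factorial * (n + 1) := Nat.mul_le_mul_right _ ih
      _ = (n + 1).factorial := by rw [Nat.factorial_succ]; ring

/-! ## §2 The level tower: the one-block term of Faà di Bruno is `De[f⁽ⁿ⁾]`, the rest sees only jets below `n` -/

section Level

variable {V : Type*} [NormedAddCommGroup V] [NormedSpace ℝ V]

/-- `iteratedFDeriv ℝ k e x (fun _ => y) = fderiv ℝ e x y` when `k = 1`. [folklore] -/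
theorem iteratedFDeriv_apply_const_of_eq_one {e : V → ℝ} {x : V} {k : ℕ} (hk : k = 1) (y : V) :
    iteratedFDeriv ℝ k e x (fun _ => y) = fderiv ℝ e x y := by
  subst hk
  rw [iteratedFDeriv_one_apply]

/-- Multilinear op-norm bound in the shape the tower uses: `|M v| ≤ Eₘ · Π F(size j)` from `‖M‖ ≤ Eₘ`, `‖v j‖ ≤ F (size j)`. [folklore] -/
theorem abs_continuousMultilinearMap_apply_le {k : ℕ} (M : ContinuousMultilinearMap ℝ (fun _ : Fin k => V) ℝ) (v : Fin k → V)
    {Em : ℝ} (hM : ‖M‖ ≤ Em) {b : Fin k → ℝ} (hv : ∀ j, ‖v j‖ ≤ b j) : |M v| ≤ Em * ∏ j, b j := by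
  rw [← Real.norm_eq_abs]
  refine (M.le_opNorm v).trans ?_
  have h0 : 0 ≤ ∏ j, ‖v j‖ := Finset.prod_nonneg fun j _ => norm_nonneg _
  exact mul_le_mul hM (Finset.prod_le_prod (fun j _ => norm_nonneg _) fun j _ => hv j) h0 ((norm_nonneg _).trans hM)

/-- **THE LEVEL TOWER (all orders).**  Let `e : V → ℝ` and `f : ℝ → V` be `Cⁿ` (`n ≥ 1`) with `e (f t) = c₀` for all `t`.  If
`‖Dᵐe(f θ)‖ ≤ E m` for `2 ≤ m ≤ n` and `‖f⁽ⁱ⁾(θ)‖ ≤ F i` for `1 ≤ i ≤ n − 1`, then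
`|De(f θ)[f⁽ⁿ⁾(θ)]| ≤ Σ_{c : OrderedFinpartition n, c.length ≠ 1} E(c.length) · Π_m F(c.partSize m)`.
Proof: Faà di Bruno along the curve (`iteratedDeriv_vcomp_eq_sum_orderedFinpartition`) gives `0 = (e∘f)⁽ⁿ⁾(θ) = Σ_c Dˡe[f⁽ˢⁱᶻᵉˢ⁾]`;
the one-block partitions contribute `k • De[f⁽ⁿ⁾]` with `k ≥ 1`, every other block has size `≤ n − 1`.
[cite: BenfattoGiulianiMastropietro2006, §2.4 Lemma 2.1 (2.40)] -/
theorem abs_fderiv_iteratedDeriv_le_of_level {e : V → ℝ} {f : ℝ → V} {θ : ℝ} {n : ℕ} (hn : 1 ≤ n) {c₀ : ℝ}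
    (hlev : ∀ t, e (f t) = c₀) (he : ContDiff ℝ n e) (hf : ContDiff ℝ n f)
    {E F : ℕ → ℝ} (hE : ∀ m, 2 ≤ m → m ≤ n → ‖iteratedFDeriv ℝ m e (f θ)‖ ≤ E m)
    (hF : ∀ i, 1 ≤ i → i ≤ n - 1 → ‖iteratedDeriv i f θ‖ ≤ F i) :
    |fderiv ℝ e (f θ) (iteratedDeriv n f θ)| ≤
      ∑ c ∈ (Finset.univ : Finset (OrderedFinpartition n)).filter (fun c => c.length ≠ 1),
        E c.length * ∏ m, F (c.partSize m) := by
  classical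
  -- Faà di Bruno along the curve, and `(e ∘ f)⁽ⁿ⁾ = 0`
  have hFdB := iteratedDeriv_vcomp_eq_sum_orderedFinpartition (𝕜 := ℝ) (i := n)
    (he.contDiffAt (x := f θ)) (hf.contDiffAt (x := θ)) le_rfl
  have hzero : iteratedDeriv n (e ∘ f) θ = 0 := by
    have hc : e ∘ f = fun _ => c₀ := funext hlev
    rw [hc, iteratedDeriv_const, if_neg (by omega)]
  rw [hzero] at hFdB
  set T : OrderedFinpartition n → ℝ := fun c =>
    iteratedFDeriv ℝ c.length e (f θ) (fun j => iteratedDeriv (c.partSize j) f θ) with hT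
  have hsum : ∑ c, T c = 0 := hFdB.symm
  -- split off the one-block partitions
  rw [← Finset.sum_filter_add_sum_filter_not Finset.univ (fun c : OrderedFinpartition n => c.length = 1)] at hsum
  set τ : ℝ := fderiv ℝ e (f θ) (iteratedDeriv n f θ) with hτ
  have hone : ∀ c ∈ Finset.univ.filter (fun c : OrderedFinpartition n => c.length = 1), T c = τ := by
    intro c hc
    have hc1 : c.length = 1 := (Finset.mem_filter.1 hc).2
    have hv : (fun j : Fin c.length => iteratedDeriv (c.partSize j) f θ) = fun _ => iteratedDeriv n f θ := by
      funext j; rw [ofp_partSize_eq_of_length_eq_one c hc1 j]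
    simp only [hT, hv]
    exact iteratedFDeriv_apply_const_of_eq_one hc1 _
  rw [Finset.sum_congr rfl hone, Finset.sum_const] at hsum
  set k := (Finset.univ.filter (fun c : OrderedFinpartition n => c.length = 1)).card with hk
  have hk1 : 1 ≤ k := by
    obtain ⟨c₁, hc₁⟩ := ofp_exists_length_eq_one hn
    exact Finset.card_pos.2 ⟨c₁, Finset.mem_filter.2 ⟨Finset.mem_univ _, hc₁⟩⟩
  -- the remaining terms see only jets below `n`
  have hrest : ∀ c ∈ Finset.univ.filter (fun c : OrderedFinpartition n => ¬c.length = 1),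
      |T c| ≤ E c.length * ∏ m, F (c.partSize m) := by
    intro c hc
    have hc1 : c.length ≠ 1 := (Finset.mem_filter.1 hc).2
    have h2 := ofp_two_le_length hn c hc1
    refine abs_continuousMultilinearMap_apply_le _ _ (hE _ h2 c.length_le) fun j => ?_
    exact hF _ (c.partSize_pos j) (ofp_partSize_le_of_length_ne_one c hc1 j)
  have hkτ : (k : ℝ) * τ = -∑ c ∈ Finset.univ.filter (fun c : OrderedFinpartition n => ¬c.length = 1), T c := by
    rw [nsmul_eq_mul] at hsum; linarith
  have habs : (k : ℝ) * |τ| ≤ ∑ c ∈ Finset.univ.filter (fun c : OrderedFinpartition n => ¬c.length = 1),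
      E c.length * ∏ m, F (c.partSize m) := by
    have hk0 : (0 : ℝ) ≤ k := by positivity
    rw [← abs_of_nonneg hk0, ← abs_mul, hkτ, abs_neg]
    exact (Finset.abs_sum_le_sum_abs _ _).trans (Finset.sum_le_sum hrest)
  have hk1' : (1 : ℝ) ≤ k := by exact_mod_cast hk1
  have hτ0 : 0 ≤ |τ| := abs_nonneg _
  have hfin : |τ| ≤ (k : ℝ) * |τ| := by nlinarith
  have hfilt : (Finset.univ.filter (fun c : OrderedFinpartition n => ¬c.length = 1)) =
      Finset.univ.filter (fun c : OrderedFinpartition n => c.length ≠ 1) := rfl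
  rw [hfilt] at habs
  exact hfin.trans habs

/-- **The crude closed form of the remainder**: for `n ≥ 1`, `E m ≤ E_max` (`2 ≤ m ≤ n`) and `0 ≤ F i ≤ Dⁱ` (`1 ≤ i ≤ n − 1`),
`Σ_{c, c.length ≠ 1} E(c.length)·Π F(c.partSize m) ≤ n!·E_max·Dⁿ` (each product is `≤ D^{Σ sizes} = Dⁿ`; at most `n!` partitions). [folklore] -/
theorem levelRemSum_le_factorial {n : ℕ} (hn : 1 ≤ n) {E F : ℕ → ℝ} {Emax D : ℝ} (hEmax : 0 ≤ Emax) (hD : 0 ≤ D)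
    (hE : ∀ m, 2 ≤ m → m ≤ n → E m ≤ Emax) (hF0 : ∀ i, 1 ≤ i → i ≤ n - 1 → 0 ≤ F i)
    (hF : ∀ i, 1 ≤ i → i ≤ n - 1 → F i ≤ D ^ i) :
    ∑ c ∈ (Finset.univ : Finset (OrderedFinpartition n)).filter (fun c => c.length ≠ 1),
        E c.length * ∏ m, F (c.partSize m) ≤ n.factorial * Emax * D ^ n := by
  classical
  have hterm : ∀ c ∈ (Finset.univ : Finset (OrderedFinpartition n)).filter (fun c => c.length ≠ 1),
      E c.length * ∏ m, F (c.partSize m) ≤ Emax * D ^ n := by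
    intro c hc
    have hc1 : c.length ≠ 1 := (Finset.mem_filter.1 hc).2
    have h2 := ofp_two_le_length hn c hc1
    have hps : ∀ m, 1 ≤ c.partSize m ∧ c.partSize m ≤ n - 1 :=
      fun m => ⟨c.partSize_pos m, ofp_partSize_le_of_length_ne_one c hc1 m⟩
    have hprod : ∏ m, F (c.partSize m) ≤ D ^ n := by
      calc ∏ m, F (c.partSize m) ≤ ∏ m, D ^ c.partSize m :=
            Finset.prod_le_prod (fun m _ => hF0 _ (hps m).1 (hps m).2) fun m _ => hF _ (hps m).1 (hps m).2
        _ = D ^ ∑ m, c.partSize m := Finset.prod_pow_eq_pow_sum _ _ _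
        _ = D ^ n := by rw [ofp_sum_partSize]
    have hprod0 : 0 ≤ ∏ m, F (c.partSize m) := Finset.prod_nonneg fun m _ => hF0 _ (hps m).1 (hps m).2
    exact mul_le_mul (hE _ h2 c.length_le) hprod hprod0 hEmax
  refine (Finset.sum_le_card_nsmul _ _ _ hterm).trans ?_
  rw [nsmul_eq_mul]
  have hcard : (((Finset.univ : Finset (OrderedFinpartition n)).filter (fun c => c.length ≠ 1)).card : ℝ) ≤ n.factorial := by
    have h1 := Finset.card_filter_le (Finset.univ : Finset (OrderedFinpartition n)) (fun c => c.length ≠ 1)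
    have h2 := card_orderedFinpartition_le_factorial n
    rw [Finset.card_univ] at h1
    exact_mod_cast h1.trans h2
  have h0 : 0 ≤ Emax * D ^ n := by positivity
  nlinarith

end Level

/-! ## §3 The polar solve `f = u • w` -/

section Polar

variable {V : Type*} [NormedAddCommGroup V] [NormedSpace ℝ V]

/-- **Leibniz with the top term split off**: `(u•w)⁽ⁿ⁾(θ) = u⁽ⁿ⁾(θ)•w(θ) + Σ_{i<n} C(n,i)•(u⁽ⁱ⁾(θ)•w⁽ⁿ⁻ⁱ⁾(θ))`. [folklore] -/
theorem iteratedDeriv_smul_eq_top_add {u : ℝ → ℝ} {w : ℝ → V} {n : ℕ} (hu : ContDiff ℝ n u) (hw : ContDiff ℝ n w) (θ : ℝ) :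
    iteratedDeriv n (fun t => u t • w t) θ = iteratedDeriv n u θ • w θ +
      ∑ i ∈ Finset.range n, (n.choose i : ℝ) • (iteratedDeriv i u θ • iteratedDeriv (n - i) w θ) := by
  have h := iteratedDerivWithin_smul (x := θ) (Set.mem_univ θ) uniqueDiffOn_univ (f := u) (g := w)
    hu.contDiffAt.contDiffWithinAt hw.contDiffAt.contDiffWithinAt
  simp only [iteratedDerivWithin_univ] at h
  have hfun : (fun t => u t • w t) = u • w := rfl
  rw [hfun, h, Finset.sum_range_succ, Nat.choose_self, one_smul, Nat.sub_self, iteratedDeriv_zero, add_comm]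
  congr 1
  refine Finset.sum_congr rfl fun i _ => ?_
  rw [Nat.cast_smul_eq_nsmul]

/-- **Size of the curve from the radius tower**: if `|u⁽ⁱ⁾(θ)| ≤ R i` (`i ≤ n`) and the frame has `‖w⁽ᵏ⁾(θ)‖ ≤ 1` (`k ≤ n`), then
`‖(u•w)⁽ⁿ⁾(θ)‖ ≤ Σ_{i ≤ n} C(n,i)·R i`. [folklore] -/
theorem norm_iteratedDeriv_smul_le_of_frame {u : ℝ → ℝ} {w : ℝ → V} {n : ℕ} (hu : ContDiff ℝ n u) (hw : ContDiff ℝ n w) (θ : ℝ)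
    {R : ℕ → ℝ} (hR : ∀ i, i ≤ n → |iteratedDeriv i u θ| ≤ R i) (hw1 : ∀ k, k ≤ n → ‖iteratedDeriv k w θ‖ ≤ 1) :
    ‖iteratedDeriv n (fun t => u t • w t) θ‖ ≤ ∑ i ∈ Finset.range (n + 1), (n.choose i : ℝ) * R i := by
  have h := iteratedDerivWithin_smul (x := θ) (Set.mem_univ θ) uniqueDiffOn_univ (f := u) (g := w)
    hu.contDiffAt.contDiffWithinAt hw.contDiffAt.contDiffWithinAt
  simp only [iteratedDerivWithin_univ] at h
  have hfun : (fun t => u t • w t) = u • w := rfl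
  rw [hfun, h]
  refine (norm_sum_le _ _).trans (Finset.sum_le_sum fun i hi => ?_)
  have hin : i ≤ n := by have := Finset.mem_range.1 hi; omega
  rw [← Nat.cast_smul_eq_nsmul ℝ, norm_smul, norm_smul, Real.norm_eq_abs, Real.norm_eq_abs, Nat.abs_cast]
  have hc0 : (0 : ℝ) ≤ n.choose i := by positivity
  calc (n.choose i : ℝ) * (|iteratedDeriv i u θ| * ‖iteratedDeriv (n - i) w θ‖)
      ≤ (n.choose i : ℝ) * (R i * 1) := by
        refine mul_le_mul_of_nonneg_left ?_ hc0
        exact mul_le_mul (hR i hin) (hw1 _ (by omega)) (norm_nonneg _) ((abs_nonneg _).trans (hR i hin))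
    _ = (n.choose i : ℝ) * R i := by ring

/-- The remainder of the split Leibniz formula is bounded by the lower radius tower: `‖Σ_{i<n} C(n,i)•(u⁽ⁱ⁾•w⁽ⁿ⁻ⁱ⁾)‖ ≤ Σ_{i<n} C(n,i)·R i`
(`|u⁽ⁱ⁾| ≤ R i` for `i ≤ n − 1`, `‖w⁽ᵏ⁾‖ ≤ 1` for `1 ≤ k ≤ n`). [folklore] -/
theorem norm_polarRem_le {u : ℝ → ℝ} {w : ℝ → V} {n : ℕ} (θ : ℝ) {R : ℕ → ℝ} (hR : ∀ i, i ≤ n - 1 → |iteratedDeriv i u θ| ≤ R i)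
    (hw1 : ∀ k, 1 ≤ k → k ≤ n → ‖iteratedDeriv k w θ‖ ≤ 1) :
    ‖∑ i ∈ Finset.range n, (n.choose i : ℝ) • (iteratedDeriv i u θ • iteratedDeriv (n - i) w θ)‖ ≤
      ∑ i ∈ Finset.range n, (n.choose i : ℝ) * R i := by
  refine (norm_sum_le _ _).trans (Finset.sum_le_sum fun i hi => ?_)
  have hin : i < n := Finset.mem_range.1 hi
  rw [norm_smul, norm_smul, Real.norm_eq_abs, Real.norm_eq_abs, Nat.abs_cast]
  have hc0 : (0 : ℝ) ≤ n.choose i := by positivity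
  have hRi := hR i (by omega)
  calc (n.choose i : ℝ) * (|iteratedDeriv i u θ| * ‖iteratedDeriv (n - i) w θ‖)
      ≤ (n.choose i : ℝ) * (R i * 1) := by
        refine mul_le_mul_of_nonneg_left ?_ hc0
        exact mul_le_mul hRi (hw1 _ (by omega) (by omega)) (norm_nonneg _) ((abs_nonneg _).trans hRi)
    _ = (n.choose i : ℝ) * R i := by ring

/-- **THE POLAR SOLVE (all orders).**  Let `f = u • w` lie in a level set of `e` (`e (u t • w t) = c₀` for all `t`), all of class `Cⁿ`
(`n ≥ 1`), with radial slope `ρ₀ ≤ De(f θ)[w θ]`, `ρ₀ > 0`.  If `‖De(f θ)‖ ≤ E₁`, `‖Dᵐe(f θ)‖ ≤ E m` (`2 ≤ m ≤ n`), `‖f⁽ⁱ⁾(θ)‖ ≤ F i`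
(`1 ≤ i ≤ n − 1`), `|u⁽ⁱ⁾(θ)| ≤ R i` (`i ≤ n − 1`) and the frame satisfies `‖w⁽ᵏ⁾(θ)‖ ≤ 1` (`1 ≤ k ≤ n`), then
`|u⁽ⁿ⁾(θ)| ≤ (Σ_{c, c.length ≠ 1} E(c.length)·Π F(c.partSize m) + E₁·Σ_{i<n} C(n,i)·R i) / ρ₀`.
[cite: BenfattoGiulianiMastropietro2006, §2.4 Lemma 2.1 (2.40)] -/
theorem abs_iteratedDeriv_radius_le_of_level {e : V → ℝ} {u : ℝ → ℝ} {w : ℝ → V} {θ : ℝ} {n : ℕ} (hn : 1 ≤ n) {c₀ : ℝ}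
    (hlev : ∀ t, e (u t • w t) = c₀) (he : ContDiff ℝ n e) (hu : ContDiff ℝ n u) (hw : ContDiff ℝ n w)
    {E F R : ℕ → ℝ} {E₁ ρ₀ : ℝ} (hρ₀ : 0 < ρ₀) (hρ : ρ₀ ≤ fderiv ℝ e (u θ • w θ) (w θ))
    (hE₁ : ‖fderiv ℝ e (u θ • w θ)‖ ≤ E₁) (hE : ∀ m, 2 ≤ m → m ≤ n → ‖iteratedFDeriv ℝ m e (u θ • w θ)‖ ≤ E m)
    (hF : ∀ i, 1 ≤ i → i ≤ n - 1 → ‖iteratedDeriv i (fun t => u t • w t) θ‖ ≤ F i)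
    (hR : ∀ i, i ≤ n - 1 → |iteratedDeriv i u θ| ≤ R i) (hw1 : ∀ k, 1 ≤ k → k ≤ n → ‖iteratedDeriv k w θ‖ ≤ 1) :
    |iteratedDeriv n u θ| ≤
      ((∑ c ∈ (Finset.univ : Finset (OrderedFinpartition n)).filter (fun c => c.length ≠ 1), E c.length * ∏ m, F (c.partSize m)) +
        E₁ * ∑ i ∈ Finset.range n, (n.choose i : ℝ) * R i) / ρ₀ := by
  have hlev' : ∀ t, e ((fun t => u t • w t) t) = c₀ := hlev
  have hmain := abs_fderiv_iteratedDeriv_le_of_level (f := fun t => u t • w t) hn hlev' he (hu.smul hw) hE hF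
  rw [iteratedDeriv_smul_eq_top_add hu hw θ, map_add, map_smul, smul_eq_mul] at hmain
  set L := fderiv ℝ e (u θ • w θ) with hL
  set s := iteratedDeriv n u θ with hs
  set rem := ∑ i ∈ Finset.range n, (n.choose i : ℝ) • (iteratedDeriv i u θ • iteratedDeriv (n - i) w θ) with hrem
  set Rem := ∑ c ∈ (Finset.univ : Finset (OrderedFinpartition n)).filter (fun c => c.length ≠ 1),
    E c.length * ∏ m, F (c.partSize m) with hRem
  have hremb : ‖rem‖ ≤ ∑ i ∈ Finset.range n, (n.choose i : ℝ) * R i := norm_polarRem_le θ hR hw1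
  have hLrem : |L rem| ≤ E₁ * ∑ i ∈ Finset.range n, (n.choose i : ℝ) * R i := by
    rw [← Real.norm_eq_abs]
    exact (L.le_opNorm rem).trans (mul_le_mul hE₁ hremb (norm_nonneg _) ((norm_nonneg _).trans hE₁))
  -- `|s|·ρ₀ ≤ |s·L w| ≤ |s·L w + L rem| + |L rem|`
  have h1 : |s| * ρ₀ ≤ |s * L (w θ)| := by
    rw [abs_mul, abs_of_pos (hρ₀.trans_le hρ)]
    exact mul_le_mul_of_nonneg_left hρ (abs_nonneg s)
  have h2 : |s * L (w θ)| ≤ |s * L (w θ) + L rem| + |L rem| := by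
    have := abs_sub (s * L (w θ) + L rem) (L rem)
    simpa using this
  rw [le_div_iff₀ hρ₀]
  linarith

end Polar

end Summit.HubbardSuperconductivity.HubbardSuperconductivity.Theorems.PerturbedFermiCurve

end
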